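import Literature.Probability.LatticeModels.BinomialEntropy
import Mathlib.MeasureTheory.Integral.Bochner.Basic
import Mathlib.MeasureTheory.Integral.DominatedConvergence
import Mathlib.MeasureTheory.Function.Floor
import Mathlib.MeasureTheory.Measure.Lebesgue.Basic
import Mathlib.Analysis.SpecialFunctions.Gaussian.GaussianIntegral
import HarnessLib

/-!
# Simon–Griffiths' approximation of `e^{-a u⁴ - b u²} du` by Curie–Weiss block spins — the analysis

Support file for the discharge of the tree's named fact
`Literature.Probability.LatticeModels.isIsingLimitLaw_phi4` (`IsingLimitLaw.lean`; the discharge is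
`IsingLimitLawProofs.lean`), following the proof of

* B. Simon, R. B. Griffiths, *The (φ⁴)₂ field theory as a classical Ising model*, Commun. Math.
  Phys. **33** (1973) 145–164, doi:10.1007/bf01645626 (`SimonGriffiths1973`; the tree's interim stub
  key `GriffithsSimon1973` is the same paper), §2, Theorem 1 (p. 148) and its proof (pp. 150–151):
  *for `a > 0`, `b ∈ ℝ`, `exp(-a s⁴ - b s²)` is a ferromagnetic limit distribution* — the densities of
  the suitably scaled total spin of `N` spins with the mean-field ferromagnetic pair interaction
  `-H_N = (N⁻¹/2 - b N^{-3/2})(Σ sᵢ)²` converge pointwise with Gaussian domination.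

Everything here is real analysis on `ℝ` (no Ising measures): the Curie–Weiss weights as explicit
binomial expressions, the step density of the scaled total spin, its pointwise limit, its Gaussian
domination, and — by dominated convergence — the limit of the lattice averages
`Σ_j W_M(j) φ(u_j) / Σ_j W_M(j)` for continuous `φ` of Gaussian growth (`tendsto_latticeAverage`).
The identification of these averages with integrals against `isingMagnetizationLaw` is done in
`IsingLimitLawProofs.lean`.

## The construction (namespace `SimonGriffiths`; parameters `a > 0`, `b : ℝ`, index `M : ℕ`)

We use `N = M⁴` spins, so that `N^{1/4} = M`, `N^{1/2} = M²`, `N^{3/4} = M³` are all natural and no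
real powers occur (the paper's `N` is arbitrary; only a subsequence is needed for a limit law).
* `scale a = λ = (12a)^{-1/4}` (as `√√(1/(12a))`, `scale_pow_four`), `beta a b = β = b λ²`: the
  paper first reduces to `a = 1/12` by the scaling `s ↦ s/λ`; we carry `λ` along instead.
* `mesh a M = δ_M = λ/M³` (the paper's mesh `δ_N = N^{-3/4}`, scaled), `gamma a b M = γ_M = 1/2 - β/M²`
  (the paper's `N⁻¹/2 - b N^{-3/2}` is `γ_M/N`); the couplings `Jᵢⱼ = γ_M/N` are `≥ 0` once
  `M ≥ 2|β| + 1` (`gamma_nonneg`).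
* `siteX M j = x_j = (2j-N)/N`, `site a M j = u_j = δ_M (2j-N) = λ M x_j` — the value of the scaled
  total spin `δ_M Σ sᵢ` when `j` spins are up; `cellIndex a M u = j_M(u) = ⌊(u/δ + N + 1)/2⌋` — the
  index of the cell `[u_j - δ, u_j + δ)` containing `u` (the paper's `μ_F(s)`, counted in up-spins);
  `roundSite a M u = v_M(u) = u_{j_M(u)}`, `|v_M(u) - u| ≤ δ_M → 0`.
* `cwWeight a b M j = W_M(j) = C(N, j) exp(γ_M N x_j²)` (the Gibbs weight of total spin `2j - N`),
  `stepDensity a b M u = g_M(u) = M² 2⁻ᴺ W_M(j_M(u))` (zero off the band; the paper's `F_N(s)` up to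
  the normalisation `c_N`, which cancels in every probability — we never need `∫ g_M → ∫ limit`
  separately from the ratio).
* `phi4Density a b u = exp(-a u⁴ - b u²)` — literally the integrand of `isIsingLimitLaw_phi4`.

## Proof architecture

1. **The exponent** (`exponent_identity`): `γ_M N x² - N h(x) = -N r(x) - (a v⁴ + b v²)` with
   `v = λ M x`, `h = spinRate`, `r = rateRem = h - x²/2 - x⁴/12 ≥ 0` (Lemma 3(a)); this is the choice of
   `γ_M` (cancel the quadratic term of `N h` up to `-b v²`) and of `δ_M` (keep the quartic term, `= -a v⁴`
   as `12 a λ⁴ = 1`).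
2. **Two forms of the scaled weight**: the Stirling form for interior `1 ≤ j ≤ N-1`
   (`scaled_cwWeight_eq`, from `choose_eq_stirlingRatio`):
   `M² 2⁻ᴺ W_M(j) = [s(N)/(s(j)s(N-j))] · √(2/(1-x_j²)) · e^{-N r(x_j)} · e^{-(a u_j⁴ + b u_j²)}`,
   and the crude bound for all `j` (`scaled_cwWeight_le_crude`, from `choose_le_exp_spinRate`):
   `M² 2⁻ᴺ W_M(j) ≤ M² e^{-(a u_j⁴ + b u_j²)}`.
3. **Pointwise limit** (`tendsto_stepDensity`): for fixed `u`, `v_M(u) → u`, `x_M = v_M/(λM) → 0`, the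
   index is eventually interior with `j, N - j ≥ M → ∞`, so the Stirling ratio `→ 1/√π`
   (`tendsto_stirlingRatio`), `√(2/(1-x²)) → √2`, `0 ≤ N r(x_M) ≤ N x_M⁶/15 = (v_M/λ)⁶/(15M²) → 0`
   (Lemma 3(b)), whence `g_M(u) → √(2/π) e^{-a u⁴ - b u²}`.
4. **Domination** (`stepDensity_le`, `stepDensity_le_gaussian` = the paper's (3)): for `M ≥ 2`,
   `g_M(u) ≤ (2C₀ + 4v²/λ²) e^{-(a v⁴ + b v²)}`, `v = v_M(u)`, `C₀ = e/(√2 π)` — interior indices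
   (`|x| ≤ 1/2`) by the Stirling form with `s(N)/(s(j)s(N-j)) ≤ C₀`, `√(2/(1-x²)) ≤ 2`; boundary ones
   (`|x| > 1/2`, where the `1/√(1-x²)` of de Moivre–Laplace blows up) by the crude bound and
   `M² ≤ 4v²/λ²`. Hence `g_M(u) ≤ R_k e^{-k u²}` for every `k ≥ 0`.
5. **Integrals** (`integral_comp_cellIndex`, `integral_roundSite_mul_stepDensity`,
   `latticeAverage_eq_integral_div`): a function of the cell index is a finite sum of indicators of
   cells, so `∫ φ(v_M(u)) g_M(u) du = 2δ_M M² 2⁻ᴺ Σ_j W_M(j) φ(u_j)` and the lattice average is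
   `∫ φ(v_M) g_M / ∫ g_M`; dominated convergence (`tendsto_integral_roundSite_mul_stepDensity`) gives
   numerator `→ √(2/π) ∫ φ e^{-a u⁴ - b u²}` for continuous `|φ(u)| ≤ A e^{B u²}`, and the ratio limit
   `tendsto_latticeAverage`.

## Deviations from the printed proof

* Stirling: Mathlib's `Stirling.stirlingSeq` with its effective bounds `√π ≤ s(n) ≤ e/√2` replaces
  the paper's Lemma 1 (`f(n) = n log n + ½ log(n+1) - n + ½ log 2π`, valid at `n = 0`); the endpoint
  indices are instead absorbed by the crude bound `C(N,j) ≤ 2ᴺ e^{-N h}`.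
* The tail estimate: the paper bounds `K_N(s) ≤ ½ log 2 + ½ log(128 s⁴ + 4)`; we use the dichotomy
  `|x| ≤ 1/2` / `|x| > 1/2` of step 4, which gives the polynomial prefactor `2C₀ + 4v²/λ²` directly.
* Subsequence `N = M⁴` and the scale `λ` carried explicitly (above).

## Junk values

All definitions are total in `M : ℕ`; at `M = 0` Mathlib's `x / 0 = 0` makes `mesh a 0 = 0`,
`gamma a b 0 = 1/2`, `siteX 0 j = 0`, `site a 0 j = 0`, `cellIndex a 0 u = 0` — harmless junk: every
lemma that needs it assumes `M ≠ 0` (or `2 ≤ M`), and the approximating sequence downstream starts at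
`M ≥ 2`. `cwWeight a b M j = 0` for `j > N` (binomial coefficient `0`) is used, not junk.

## Not here

Ising measures, `IsIsingLimitLaw`, the Lee–Yang/GHS consequences (§3 of the paper).
-/

noncomputable section

open Real Filter Topology Set MeasureTheory

namespace Literature.Probability.LatticeModels

namespace SimonGriffiths

/-! ### Constants -/

/-- The length scale `λ = (12a)^{-1/4}` (so that `u⁴/(12 λ⁴) = a u⁴`). [cite: SimonGriffiths1973, §2 proof of Thm. 1] -/
def scale (a : ℝ) : ℝ := Real.sqrt (Real.sqrt (12 * a)⁻¹)

/-- `λ > 0`. [folklore] -/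
theorem scale_pos {a : ℝ} (ha : 0 < a) : 0 < scale a := by
  unfold scale; positivity

/-- `λ⁴ = 1/(12a)`. [folklore] -/
theorem scale_pow_four {a : ℝ} (ha : 0 < a) : scale a ^ 4 = (12 * a)⁻¹ := by
  have h1 : (0 : ℝ) ≤ (12 * a)⁻¹ := by positivity
  have : scale a ^ 4 = (Real.sqrt (Real.sqrt (12 * a)⁻¹) ^ 2) ^ 2 := by unfold scale; ring
  rw [this, Real.sq_sqrt (Real.sqrt_nonneg _), Real.sq_sqrt h1]

/-- `a = 1/(12 λ⁴)`, in the form `a v⁴ = (v/λ)⁴/12`-ready: `12 a λ⁴ = 1`. [folklore] -/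
theorem scale_pow_four_mul {a : ℝ} (ha : 0 < a) : 12 * a * scale a ^ 4 = 1 := by
  rw [scale_pow_four ha]; field_simp

/-- The shifted quadratic coefficient `β = b λ²`. [cite: SimonGriffiths1973, §2 proof of Thm. 1] -/
def beta (a b : ℝ) : ℝ := b * scale a ^ 2

/-- The mesh `δ_M = λ / M³` (half the lattice spacing of the magnetization `δ Σ sᵢ`; junk `0` at
`M = 0`). [cite: SimonGriffiths1973, §2 proof of Thm. 1] -/
def mesh (a : ℝ) (M : ℕ) : ℝ := scale a / (M : ℝ) ^ 3

/-- `δ_M > 0`. [folklore] -/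
theorem mesh_pos {a : ℝ} (ha : 0 < a) {M : ℕ} (hM : M ≠ 0) : 0 < mesh a M := by
  unfold mesh; have := scale_pos ha; positivity

/-- `δ_M ≤ λ` for `M ≥ 1`. [folklore] -/
theorem mesh_le_scale {a : ℝ} (ha : 0 < a) {M : ℕ} (hM : M ≠ 0) : mesh a M ≤ scale a := by
  unfold mesh
  have hM' : (1 : ℝ) ≤ (M : ℝ) ^ 3 := one_le_pow₀ (by exact_mod_cast Nat.one_le_iff_ne_zero.2 hM)
  exact div_le_self (scale_pos ha).le hM'

/-- `δ_M → 0`. [folklore] -/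
theorem tendsto_mesh (a : ℝ) : Tendsto (fun M => mesh a M) atTop (𝓝 0) := by
  unfold mesh
  have h : Tendsto (fun M : ℕ => ((M : ℝ) ^ 3)⁻¹) atTop (𝓝 0) := by
    have := (tendsto_pow_atTop (α := ℝ) (n := 3) (by norm_num)).comp tendsto_natCast_atTop_atTop
    exact this.inv_tendsto_atTop
  simpa [div_eq_mul_inv] using h.const_mul (scale a)

/-- The Curie–Weiss coupling strength `γ_M = 1/2 - β/M²` (couplings `Jᵢⱼ = γ_M / M⁴`; junk `1/2`
at `M = 0`). [cite: SimonGriffiths1973, §2 proof of Thm. 1] -/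
def gamma (a b : ℝ) (M : ℕ) : ℝ := 1 / 2 - beta a b / (M : ℝ) ^ 2

/-- `γ_M ≥ 0` once `M ≥ 2|β| + 1`. [cite: SimonGriffiths1973, §2 proof of Thm. 1] -/
theorem gamma_nonneg {a b : ℝ} {M : ℕ} (hM : 2 * |beta a b| + 1 ≤ M) : 0 ≤ gamma a b M := by
  unfold gamma
  have hM1 : (1 : ℝ) ≤ M := by linarith [abs_nonneg (beta a b)]
  have hM2 : (M : ℝ) ≤ (M : ℝ) ^ 2 := by nlinarith
  have hb : beta a b ≤ |beta a b| := le_abs_self _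
  rw [sub_nonneg, div_le_iff₀ (by positivity)]
  nlinarith [abs_nonneg (beta a b)]

/-! ### The lattice of magnetization values -/

/-- The reduced variable `x_j = (2j - N)/N`, `N = M⁴` (junk `0` at `M = 0`).
[cite: SimonGriffiths1973, §2 proof of Thm. 1] -/
def siteX (M : ℕ) (j : ℤ) : ℝ := (2 * (j : ℝ) - (M : ℝ) ^ 4) / (M : ℝ) ^ 4

/-- The lattice point `u_j = δ_M (2j - N) = λ M x_j`. [cite: SimonGriffiths1973, §2 proof of Thm. 1] -/
def site (a : ℝ) (M : ℕ) (j : ℤ) : ℝ := mesh a M * (2 * (j : ℝ) - (M : ℝ) ^ 4)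

/-- `u_j = λ M x_j`. [folklore] -/
theorem site_eq {a : ℝ} {M : ℕ} (hM : M ≠ 0) (j : ℤ) :
    site a M j = scale a * M * siteX M j := by
  unfold site siteX mesh
  have : (M : ℝ) ≠ 0 := by exact_mod_cast hM
  field_simp

/-- The index of the cell `[u_j - δ, u_j + δ)` containing `u`: `j_M(u) = ⌊(u/δ + N + 1)/2⌋` (the
paper's `μ_F(s)`, shifted to count up-spins; junk `0` at `M = 0`, where `δ = 0`).
[cite: SimonGriffiths1973, §2 (definition of μ_F)] -/
def cellIndex (a : ℝ) (M : ℕ) (u : ℝ) : ℤ := ⌊(u / mesh a M + (M : ℝ) ^ 4 + 1) / 2⌋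

/-- `j_M(u) = j` iff `u ∈ [u_j - δ, u_j + δ)`. [folklore] -/
theorem cellIndex_eq_iff {a : ℝ} (ha : 0 < a) {M : ℕ} (hM : M ≠ 0) (u : ℝ) (j : ℤ) :
    cellIndex a M u = j ↔ site a M j - mesh a M ≤ u ∧ u < site a M j + mesh a M := by
  have hδ := mesh_pos ha hM
  unfold cellIndex site
  rw [Int.floor_eq_iff]
  constructor
  · rintro ⟨h1, h2⟩
    constructor
    · have : (2 * (j : ℝ) - (M : ℝ) ^ 4) - 1 ≤ u / mesh a M := by linarith
      have := (le_div_iff₀ hδ).1 this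
      linarith
    · have : u / mesh a M < (2 * (j : ℝ) - (M : ℝ) ^ 4) + 1 := by linarith
      have := (div_lt_iff₀ hδ).1 this
      linarith
  · rintro ⟨h1, h2⟩
    constructor
    · have : (2 * (j : ℝ) - (M : ℝ) ^ 4) - 1 ≤ u / mesh a M := by
        rw [le_div_iff₀ hδ]; linarith
      linarith
    · have : u / mesh a M < (2 * (j : ℝ) - (M : ℝ) ^ 4) + 1 := by
        rw [div_lt_iff₀ hδ]; linarith
      linarith

/-- The cell of `u`: `u ∈ [u_{j(u)} - δ, u_{j(u)} + δ)`. [folklore] -/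
theorem site_cellIndex_le {a : ℝ} (ha : 0 < a) {M : ℕ} (hM : M ≠ 0) (u : ℝ) :
    site a M (cellIndex a M u) - mesh a M ≤ u ∧ u < site a M (cellIndex a M u) + mesh a M :=
  (cellIndex_eq_iff ha hM u _).1 rfl

/-- The lattice point of the cell of `u` (the paper's `μ_F(s) δ`). [cite: SimonGriffiths1973, §2] -/
def roundSite (a : ℝ) (M : ℕ) (u : ℝ) : ℝ := site a M (cellIndex a M u)

/-- `|v_M(u) - u| ≤ δ_M`. [cite: SimonGriffiths1973, §2 (|μ_F(s)δ - s| ≤ δ)] -/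
theorem abs_roundSite_sub_le {a : ℝ} (ha : 0 < a) {M : ℕ} (hM : M ≠ 0) (u : ℝ) :
    |roundSite a M u - u| ≤ mesh a M := by
  have := site_cellIndex_le ha hM u
  rw [abs_le]; unfold roundSite; constructor <;> linarith [this.1, this.2]

/-- `v_M(u) → u`. [folklore] -/
theorem tendsto_roundSite {a : ℝ} (ha : 0 < a) (u : ℝ) :
    Tendsto (fun M => roundSite a M u) atTop (𝓝 u) := by
  rw [tendsto_iff_norm_sub_tendsto_zero]
  refine squeeze_zero' (Eventually.of_forall fun M => norm_nonneg _) ?_ (tendsto_mesh a)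
  filter_upwards [eventually_ne_atTop 0] with M hM
  exact abs_roundSite_sub_le ha hM u

/-- `j_M` is measurable. [folklore] -/
theorem measurable_cellIndex (a : ℝ) (M : ℕ) : Measurable (cellIndex a M) := by
  unfold cellIndex
  exact Int.measurable_floor.comp (by fun_prop)

/-- Any function of the cell index is measurable. [folklore] -/
theorem measurable_comp_cellIndex (a : ℝ) (M : ℕ) (F : ℤ → ℝ) :
    Measurable fun u => F (cellIndex a M u) :=
  (measurable_from_top (f := F)).comp (measurable_cellIndex a M)

/-- **Step functions on the lattice integrate to lattice sums**: if `F : ℤ → ℝ` vanishes off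
`[0, N]` then `∫ F(j_M(u)) du = 2δ Σ_{j=0}^{N} F(j)`. [folklore] -/
theorem integral_comp_cellIndex {a : ℝ} (ha : 0 < a) {M : ℕ} (hM : M ≠ 0) (F : ℤ → ℝ)
    (hF : ∀ j, F j ≠ 0 → 0 ≤ j ∧ j ≤ (M : ℤ) ^ 4) :
    ∫ u, F (cellIndex a M u) = 2 * mesh a M * ∑ j ∈ Finset.range (M ^ 4 + 1), F j := by
  have hδ := mesh_pos ha hM
  -- pointwise: `F ∘ j_M` is a finite sum of indicators of cells
  have hpt : ∀ u, F (cellIndex a M u) = ∑ j ∈ Finset.range (M ^ 4 + 1),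
      (Set.Ico (site a M j - mesh a M) (site a M j + mesh a M)).indicator (fun _ => F j) u := by
    intro u
    by_cases hz : 0 ≤ cellIndex a M u ∧ cellIndex a M u ≤ (M : ℤ) ^ 4
    · have hmem : (cellIndex a M u).toNat ∈ Finset.range (M ^ 4 + 1) := by
        rw [Finset.mem_range, Nat.lt_succ_iff]
        have : ((cellIndex a M u).toNat : ℤ) ≤ (M : ℤ) ^ 4 := by
          rw [Int.toNat_of_nonneg hz.1]; exact hz.2
        exact_mod_cast this
      rw [Finset.sum_eq_single_of_mem _ hmem]
      · have hc : ((cellIndex a M u).toNat : ℤ) = cellIndex a M u := Int.toNat_of_nonneg hz.1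
        rw [hc, Set.indicator_of_mem]
        exact (cellIndex_eq_iff ha hM u _).1 rfl
      · intro j _ hj
        rw [Set.indicator_of_notMem]
        intro hmem'
        exact hj (by have := (cellIndex_eq_iff ha hM u j).2 hmem'; rw [this, Int.toNat_natCast])
    · have h0 : F (cellIndex a M u) = 0 := by
        by_contra h; exact hz (hF _ h)
      rw [h0, eq_comm]
      refine Finset.sum_eq_zero fun j hj => ?_
      rw [Set.indicator_of_notMem]
      intro hmem'
      have := (cellIndex_eq_iff ha hM u j).2 hmem'
      apply hz
      rw [this]
      refine ⟨by positivity, ?_⟩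
      exact_mod_cast Nat.lt_succ_iff.1 (Finset.mem_range.1 hj)
  simp_rw [hpt]
  rw [integral_finsetSum _ fun j _ => ?_]
  · rw [Finset.mul_sum]
    refine Finset.sum_congr rfl fun j _ => ?_
    rw [integral_indicator_const _ measurableSet_Ico, Real.volume_real_Ico_of_le (by linarith),
      smul_eq_mul]
    ring
  · exact (integrableOn_const (by simp [Real.volume_Ico])).integrable_indicator measurableSet_Ico

/-! ### The Curie–Weiss weights and the step density -/

/-- The remainder `r(x) = h(x) - x²/2 - x⁴/12 ≥ 0` of the rate function. [cite: SimonGriffiths1973, §2 Lemma 3] -/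
def rateRem (x : ℝ) : ℝ := spinRate x - x ^ 2 / 2 - x ^ 4 / 12

/-- `0 ≤ r(x)` on `[-1, 1]`. [cite: SimonGriffiths1973, §2 Lemma 3(a)] -/
theorem rateRem_nonneg {x : ℝ} (hx : x ∈ Set.Icc (-1 : ℝ) 1) : 0 ≤ rateRem x := by
  have := sq_add_pow_four_le_spinRate hx
  unfold rateRem; linarith

/-- `r(x) ≤ x⁶/15` on `[-1/2, 1/2]`. [cite: SimonGriffiths1973, §2 Lemma 3(b)] -/
theorem rateRem_le {x : ℝ} (hx : x ∈ Set.Icc (-(1 / 2) : ℝ) (1 / 2)) : rateRem x ≤ x ^ 6 / 15 := by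
  have := spinRate_le_taylor hx
  unfold rateRem; linarith

/-- The Curie–Weiss weight of total spin `2j - N`: `W_M(j) = C(N, j) exp(γ_M N x_j²)`
(`γ_M N x_j² = (γ_M/N)(2j-N)² = Σᵢⱼ Jᵢⱼ sᵢ sⱼ` for `Jᵢⱼ = γ_M/N`); zero for `j > N`.
[cite: SimonGriffiths1973, §2 proof of Thm. 1] -/
def cwWeight (a b : ℝ) (M j : ℕ) : ℝ :=
  ((M ^ 4).choose j : ℝ) * Real.exp (gamma a b M * (M : ℝ) ^ 4 * siteX M j ^ 2)

/-- `0 ≤ W_M(j)`. [folklore] -/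
theorem cwWeight_nonneg (a b : ℝ) (M j : ℕ) : 0 ≤ cwWeight a b M j := by
  unfold cwWeight; positivity

/-- `0 < W_M(j)` for `j ≤ N`. [folklore] -/
theorem cwWeight_pos (a b : ℝ) {M j : ℕ} (hj : j ≤ M ^ 4) : 0 < cwWeight a b M j := by
  unfold cwWeight
  have : 0 < ((M ^ 4).choose j : ℝ) := by exact_mod_cast Nat.choose_pos hj
  positivity

/-- `W_M(j) = 0` for `j > N`. [folklore] -/
theorem cwWeight_eq_zero (a b : ℝ) {M j : ℕ} (hj : M ^ 4 < j) : cwWeight a b M j = 0 := by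
  simp [cwWeight, Nat.choose_eq_zero_of_lt hj]

/-- **The step density** `g_M(u) = M² 2⁻ᴺ W_M(j_M(u))` (the paper's `F_N(s)` up to the constant
normalisation `c_N`, which cancels in probabilities; `M² = √N`). [cite: SimonGriffiths1973, §2 proof of Thm. 1] -/
def stepDensity (a b : ℝ) (M : ℕ) (u : ℝ) : ℝ :=
  if 0 ≤ cellIndex a M u then
    (M : ℝ) ^ 2 / 2 ^ (M ^ 4) * cwWeight a b M (cellIndex a M u).toNat
  else 0

/-- `0 ≤ g_M`. [folklore] -/
theorem stepDensity_nonneg (a b : ℝ) (M : ℕ) (u : ℝ) : 0 ≤ stepDensity a b M u := by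
  unfold stepDensity
  split_ifs
  · exact mul_nonneg (by positivity) (cwWeight_nonneg a b M _)
  · exact le_rfl

/-- **The key algebraic identity** behind the choice of `γ_M` and `δ_M`:
`γ_M N x² - N h(x) = -N r(x) - (a v⁴ + b v²)` for `v = λ M x` (the quadratic term of `N h` is
cancelled up to `-b v²`, the quartic one is `-a v⁴`). [cite: SimonGriffiths1973, §2 proof of Thm. 1] -/
theorem exponent_identity {a : ℝ} (ha : 0 < a) (b : ℝ) {M : ℕ} (hM : M ≠ 0) (x : ℝ) :
    gamma a b M * (M : ℝ) ^ 4 * x ^ 2 - (M : ℝ) ^ 4 * spinRate x =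
      -((M : ℝ) ^ 4 * rateRem x) - (a * (scale a * M * x) ^ 4 + b * (scale a * M * x) ^ 2) := by
  have h4 := scale_pow_four_mul ha
  have hM' : (M : ℝ) ≠ 0 := by exact_mod_cast hM
  unfold gamma beta rateRem
  field_simp
  linear_combination (2 * (M : ℝ) ^ 2 * x ^ 4) * h4

/-- The reduced variable of `0 ≤ j ≤ N` lies in `[-1, 1]`. [folklore] -/
theorem siteX_mem_Icc {M : ℕ} (hM : M ≠ 0) {j : ℕ} (hj : j ≤ M ^ 4) :
    siteX M j ∈ Set.Icc (-1 : ℝ) 1 := by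
  unfold siteX
  have hN : (0 : ℝ) < (M : ℝ) ^ 4 := by positivity
  have hj' : ((j : ℤ) : ℝ) ≤ (M : ℝ) ^ 4 := by exact_mod_cast hj
  have hj0 : (0 : ℝ) ≤ ((j : ℤ) : ℝ) := by exact_mod_cast Nat.zero_le j
  constructor
  · rw [le_div_iff₀ hN]; linarith
  · rw [div_le_iff₀ hN]; linarith

/-- **Crude bound**: `M² 2⁻ᴺ W_M(j) ≤ M² exp(-(a u_j⁴ + b u_j²))` for all `0 ≤ j ≤ N`.
[cite: SimonGriffiths1973, §2 proof of Thm. 1] -/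
theorem scaled_cwWeight_le_crude {a : ℝ} (ha : 0 < a) (b : ℝ) {M : ℕ} (hM : M ≠ 0) {j : ℕ}
    (hj : j ≤ M ^ 4) :
    (M : ℝ) ^ 2 / 2 ^ (M ^ 4) * cwWeight a b M j ≤
      (M : ℝ) ^ 2 * Real.exp (-(a * site a M j ^ 4 + b * site a M j ^ 2)) := by
  have hc := choose_le_exp_spinRate (N := M ^ 4) hj
  have hx : ((2 : ℝ) * j - ((M ^ 4 : ℕ) : ℝ)) / ((M ^ 4 : ℕ) : ℝ) = siteX M j := by
    simp [siteX]
  rw [hx] at hc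
  have hid := exponent_identity ha b hM (siteX M j)
  rw [← site_eq hM] at hid
  have hr := rateRem_nonneg (siteX_mem_Icc hM hj)
  unfold cwWeight
  calc (M : ℝ) ^ 2 / 2 ^ (M ^ 4) * (((M ^ 4).choose j : ℝ) *
        Real.exp (gamma a b M * (M : ℝ) ^ 4 * siteX M j ^ 2))
      ≤ (M : ℝ) ^ 2 / 2 ^ (M ^ 4) * ((2 ^ (M ^ 4) *
          Real.exp (-(((M ^ 4 : ℕ) : ℝ) * spinRate (siteX M j)))) *
        Real.exp (gamma a b M * (M : ℝ) ^ 4 * siteX M j ^ 2)) := by gcongr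
    _ = (M : ℝ) ^ 2 * Real.exp (gamma a b M * (M : ℝ) ^ 4 * siteX M j ^ 2 -
          (M : ℝ) ^ 4 * spinRate (siteX M j)) := by
        rw [Real.exp_sub, Real.exp_neg]; push_cast; field_simp
    _ ≤ (M : ℝ) ^ 2 * Real.exp (-(a * site a M j ^ 4 + b * site a M j ^ 2)) := by
        rw [hid]; gcongr; nlinarith [hr, pow_nonneg (Nat.cast_nonneg (α := ℝ) M) 4]

/-- `M² √(N/(2j(N-j))) = √(2/(1 - x_j²))` (`M² = √N`). [folklore] -/
theorem sq_mul_sqrt_eq {M : ℕ} (hM : M ≠ 0) {j : ℕ} (hj : 1 ≤ j) (hjN : j + 1 ≤ M ^ 4) :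
    (M : ℝ) ^ 2 * Real.sqrt (((M ^ 4 : ℕ) : ℝ) / (2 * j * (((M ^ 4 : ℕ) : ℝ) - j))) =
      Real.sqrt (2 / (1 - siteX M j ^ 2)) := by
  have hM' : (0 : ℝ) < M := by exact_mod_cast Nat.pos_of_ne_zero hM
  have hp : (0 : ℝ) < j := by exact_mod_cast hj
  have hq : (j : ℝ) < (M : ℝ) ^ 4 := by exact_mod_cast hjN
  have hsq : (M : ℝ) ^ 2 = Real.sqrt ((M : ℝ) ^ 4) := by
    rw [show (M : ℝ) ^ 4 = ((M : ℝ) ^ 2) ^ 2 by ring, Real.sqrt_sq (by positivity)]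
  rw [hsq, ← Real.sqrt_mul (by positivity)]
  congr 1
  have h1 : (M : ℝ) ^ 4 - j ≠ 0 := by linarith
  have hx2 : 1 - siteX M j ^ 2 = 4 * j * ((M : ℝ) ^ 4 - j) / ((M : ℝ) ^ 4) ^ 2 := by
    unfold siteX; push_cast; field_simp; ring
  rw [hx2]
  push_cast
  field_simp
  ring

/-- **Stirling form of the scaled weight** for `1 ≤ j ≤ N - 1`:
`M² 2⁻ᴺ W_M(j) = [s(N)/(s(j)s(N-j))] · √(2/(1-x_j²)) · e^{-N r(x_j)} · e^{-(a u_j⁴ + b u_j²)}`.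
[cite: SimonGriffiths1973, §2 proof of Thm. 1] -/
theorem scaled_cwWeight_eq {a : ℝ} (ha : 0 < a) (b : ℝ) {M : ℕ} (hM : M ≠ 0) {j : ℕ}
    (hj : 1 ≤ j) (hjN : j + 1 ≤ M ^ 4) :
    (M : ℝ) ^ 2 / 2 ^ (M ^ 4) * cwWeight a b M j =
      stirlingRatio (M ^ 4) j * Real.sqrt (2 / (1 - siteX M j ^ 2)) *
        Real.exp (-((M : ℝ) ^ 4 * rateRem (siteX M j))) *
          Real.exp (-(a * site a M j ^ 4 + b * site a M j ^ 2)) := by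
  have hc := choose_eq_stirlingRatio hj hjN
  have hx : ((2 : ℝ) * j - ((M ^ 4 : ℕ) : ℝ)) / ((M ^ 4 : ℕ) : ℝ) = siteX M j := by
    simp [siteX]
  rw [hx] at hc
  have hid := exponent_identity ha b hM (siteX M j)
  rw [← site_eq hM] at hid
  unfold cwWeight
  rw [hc, mul_assoc (stirlingRatio _ _ * _), mul_assoc (stirlingRatio _ _ * _),
    ← Real.exp_add, ← sq_mul_sqrt_eq hM hj hjN]
  have : -((M : ℝ) ^ 4 * rateRem (siteX M j)) + -(a * site a M ↑j ^ 4 + b * site a M ↑j ^ 2) =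
      gamma a b M * (M : ℝ) ^ 4 * siteX M j ^ 2 + -((M : ℝ) ^ 4 * spinRate (siteX M j)) := by
    linarith [hid]
  rw [this, Real.exp_add]
  push_cast
  field_simp

/-! ### Where the cell index falls -/

/-- If `|x_z| ≤ 1/2` and `M ≥ 2` then `z` is an interior index: `N/4 ≤ z ≤ 3N/4`, whence
`1 ≤ z ≤ N - 1` and `z, N - z ≥ M`. [folklore] -/
theorem index_interior {M : ℕ} (hM : 2 ≤ M) {z : ℤ} (hx : |siteX M z| ≤ 1 / 2) :
    0 ≤ z ∧ 1 ≤ z.toNat ∧ z.toNat + 1 ≤ M ^ 4 ∧ M ≤ z.toNat ∧ M ≤ M ^ 4 - z.toNat := by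
  have hM' : (2 : ℝ) ≤ M := by exact_mod_cast hM
  have hN : (0 : ℝ) < (M : ℝ) ^ 4 := by positivity
  have hN16 : (16 : ℝ) ≤ (M : ℝ) ^ 4 := by
    have := pow_le_pow_left₀ (by norm_num : (0 : ℝ) ≤ 2) hM' 4
    norm_num at this; exact this
  have hNM : 4 * (M : ℝ) ≤ (M : ℝ) ^ 4 := by
    have h8 := pow_le_pow_left₀ (by norm_num : (0 : ℝ) ≤ 2) hM' 3
    have : (M : ℝ) ^ 4 = M * (M : ℝ) ^ 3 := by ring
    rw [this]; norm_num at h8; nlinarith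
  rw [abs_le] at hx
  unfold siteX at hx
  rw [le_div_iff₀ hN, div_le_iff₀ hN] at hx
  obtain ⟨h1, h2⟩ := hx
  have hz0 : (0 : ℝ) ≤ (z : ℝ) := by nlinarith
  have hz0' : 0 ≤ z := by exact_mod_cast hz0
  have hzj : ((z.toNat : ℕ) : ℤ) = z := Int.toNat_of_nonneg hz0'
  have hjr : ((z.toNat : ℕ) : ℝ) = (z : ℝ) := by exact_mod_cast hzj
  refine ⟨hz0', ?_, ?_, ?_, ?_⟩
  · have : (1 : ℝ) ≤ (z.toNat : ℕ) := by rw [hjr]; nlinarith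
    exact_mod_cast this
  · have : ((z.toNat : ℕ) : ℝ) + 1 ≤ (M : ℝ) ^ 4 := by rw [hjr]; nlinarith
    exact_mod_cast this
  · have : (M : ℝ) ≤ (z.toNat : ℕ) := by rw [hjr]; nlinarith
    exact_mod_cast this
  · have : (M : ℝ) + (z.toNat : ℕ) ≤ (M : ℝ) ^ 4 := by rw [hjr]; nlinarith
    have h' : M + z.toNat ≤ M ^ 4 := by exact_mod_cast this
    omega

/-- If `|x_z| > 1/2` then `M² ≤ 4 u_z²/λ²` (`u_z = λ M x_z`). [folklore] -/
theorem sq_le_of_half_lt {a : ℝ} (ha : 0 < a) {M : ℕ} (hM : M ≠ 0) {z : ℤ}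
    (hx : 1 / 2 < |siteX M z|) : (M : ℝ) ^ 2 ≤ 4 * site a M z ^ 2 / scale a ^ 2 := by
  have hsc := scale_pos ha
  rw [site_eq hM, le_div_iff₀ (by positivity)]
  have h4 : 1 / 4 < siteX M z ^ 2 := by
    have : (1 / 2) ^ 2 < |siteX M z| ^ 2 := by gcongr
    rw [sq_abs] at this; linarith
  nlinarith [sq_nonneg (scale a * M)]

/-- The Stirling constant bound `C₀ = e/(√2 π)`. [folklore] -/
def stirlingConst : ℝ := Real.exp 1 / (Real.sqrt 2 * π)

/-- `0 ≤ C₀`. [folklore] -/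
theorem stirlingConst_nonneg : 0 ≤ stirlingConst := by unfold stirlingConst; positivity

/-- **Domination** (the paper's display before (3)): for `M ≥ 2` and all `u`,
`g_M(u) ≤ (2C₀ + 4 v²/λ²) exp(-(a v⁴ + b v²))`, `v = v_M(u)` the lattice point of the cell of `u`.
[cite: SimonGriffiths1973, §2 proof of Thm. 1] -/
theorem stepDensity_le {a : ℝ} (ha : 0 < a) (b : ℝ) {M : ℕ} (hM : 2 ≤ M) (u : ℝ) :
    stepDensity a b M u ≤ (2 * stirlingConst + 4 * roundSite a M u ^ 2 / scale a ^ 2) *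
      Real.exp (-(a * roundSite a M u ^ 4 + b * roundSite a M u ^ 2)) := by
  have hM0 : M ≠ 0 := by omega
  have hsc := scale_pos ha
  have hC := stirlingConst_nonneg
  have hR : 0 ≤ (2 * stirlingConst + 4 * roundSite a M u ^ 2 / scale a ^ 2) *
      Real.exp (-(a * roundSite a M u ^ 4 + b * roundSite a M u ^ 2)) := by positivity
  unfold stepDensity
  split_ifs with hz
  · have hzj : (((cellIndex a M u).toNat : ℕ) : ℤ) = cellIndex a M u := Int.toNat_of_nonneg hz
    have hv : roundSite a M u = site a M ((cellIndex a M u).toNat : ℕ) := by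
      unfold roundSite; rw [hzj]
    rw [hv]
    set j : ℕ := (cellIndex a M u).toNat with hjdef
    by_cases hjN : j ≤ M ^ 4
    · by_cases hx : |siteX M j| ≤ 1 / 2
      · -- interior index: Stirling form
        obtain ⟨-, hj1, hj2, -, -⟩ := index_interior hM hx
        rw [Int.toNat_natCast] at hj1 hj2
        rw [scaled_cwWeight_eq ha b hM0 hj1 hj2]
        have h1 : stirlingRatio (M ^ 4) j ≤ stirlingConst := stirlingRatio_le hj1 hj2
        have h2 : Real.sqrt (2 / (1 - siteX M j ^ 2)) ≤ 2 := by
          have hx2 : siteX M j ^ 2 ≤ 1 / 4 := by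
            have : |siteX M j| ^ 2 ≤ (1 / 2) ^ 2 := by gcongr
            rw [sq_abs] at this; linarith
          rw [Real.sqrt_le_left (by norm_num : (0 : ℝ) ≤ 2), div_le_iff₀ (by linarith)]
          linarith
        have h3 : Real.exp (-((M : ℝ) ^ 4 * rateRem (siteX M j))) ≤ 1 := by
          rw [Real.exp_le_one_iff, neg_nonpos]
          exact mul_nonneg (by positivity) (rateRem_nonneg (siteX_mem_Icc hM0 hjN))
        have h0 : 0 ≤ stirlingRatio (M ^ 4) j := (stirlingRatio_pos hj1 hj2).le
        calc stirlingRatio (M ^ 4) j * Real.sqrt (2 / (1 - siteX M j ^ 2)) *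
              Real.exp (-((M : ℝ) ^ 4 * rateRem (siteX M j))) *
              Real.exp (-(a * site a M j ^ 4 + b * site a M j ^ 2))
            ≤ stirlingConst * 2 * 1 * Real.exp (-(a * site a M j ^ 4 + b * site a M j ^ 2)) := by
              gcongr
          _ ≤ _ := by
              gcongr
              nlinarith [sq_nonneg (site a M j), div_nonneg (mul_nonneg (by norm_num : (0:ℝ) ≤ 4)
                (sq_nonneg (site a M (j : ℤ)))) (sq_nonneg (scale a))]
      · -- boundary index: crude bound and `M² ≤ 4v²/λ²`
        have hcr := scaled_cwWeight_le_crude ha b hM0 hjN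
        have hM2 := sq_le_of_half_lt ha hM0 (not_le.1 hx)
        calc (M : ℝ) ^ 2 / 2 ^ (M ^ 4) * cwWeight a b M j
            ≤ (M : ℝ) ^ 2 * Real.exp (-(a * site a M j ^ 4 + b * site a M j ^ 2)) := hcr
          _ ≤ (4 * site a M j ^ 2 / scale a ^ 2) *
              Real.exp (-(a * site a M j ^ 4 + b * site a M j ^ 2)) := by gcongr
          _ ≤ _ := by gcongr; linarith
    · rw [cwWeight_eq_zero a b (not_le.1 hjN), mul_zero]
      positivity
  · exact hR

/-- **Gaussian domination** (the paper's (3)): for every `k ≥ 0` there is `R` with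
`g_M(u) ≤ R e^{-k u²}` for all `M ≥ 2` and all `u`. [cite: SimonGriffiths1973, §2 eq. (3)] -/
theorem stepDensity_le_gaussian {a : ℝ} (ha : 0 < a) (b : ℝ) {k : ℝ} (hk : 0 ≤ k) :
    ∃ R : ℝ, 0 ≤ R ∧ ∀ M : ℕ, 2 ≤ M → ∀ u : ℝ,
      stepDensity a b M u ≤ R * Real.exp (-k * u ^ 2) := by
  have hsc := scale_pos ha
  set c : ℝ := 2 * k - b + 1
  refine ⟨(2 * stirlingConst + 4 / scale a ^ 2) * Real.exp (c ^ 2 / (4 * a)) *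
    Real.exp (2 * k * scale a ^ 2), by have := stirlingConst_nonneg; positivity, fun M hM u => ?_⟩
  have hM0 : M ≠ 0 := by omega
  refine (stepDensity_le ha b hM u).trans ?_
  set v := roundSite a M u
  -- `(2C₀ + 4v²/λ²) ≤ (2C₀ + 4/λ²) e^{v²}`
  have h1 : 2 * stirlingConst + 4 * v ^ 2 / scale a ^ 2 ≤
      (2 * stirlingConst + 4 / scale a ^ 2) * Real.exp (v ^ 2) := by
    have he : v ^ 2 ≤ Real.exp (v ^ 2) := (by linarith [Real.add_one_le_exp (v ^ 2)])
    have he1 : 1 ≤ Real.exp (v ^ 2) := Real.one_le_exp (sq_nonneg v)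
    have hC := stirlingConst_nonneg
    have hA : 2 * stirlingConst ≤ 2 * stirlingConst * Real.exp (v ^ 2) :=
      le_mul_of_one_le_right (by positivity) he1
    have hB : 4 * v ^ 2 / scale a ^ 2 ≤ 4 / scale a ^ 2 * Real.exp (v ^ 2) := by
      rw [div_mul_eq_mul_div, div_le_div_iff_of_pos_right (by positivity)]
      nlinarith
    calc 2 * stirlingConst + 4 * v ^ 2 / scale a ^ 2
        ≤ 2 * stirlingConst * Real.exp (v ^ 2) + 4 / scale a ^ 2 * Real.exp (v ^ 2) :=
          add_le_add hA hB
      _ = (2 * stirlingConst + 4 / scale a ^ 2) * Real.exp (v ^ 2) := by ring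
  -- `-a v⁴ + c v² ≤ c²/(4a)`
  have h2 : -(a * v ^ 4 + b * v ^ 2) + v ^ 2 + 2 * k * v ^ 2 ≤ c ^ 2 / (4 * a) := by
    rw [le_div_iff₀ (by positivity)]
    nlinarith [sq_nonneg (2 * a * v ^ 2 - c)]
  -- `-2k v² ≤ -k u² + 2kλ²`
  have h3 : -(2 * k * v ^ 2) ≤ -k * u ^ 2 + 2 * k * scale a ^ 2 := by
    have hd : |v - u| ≤ scale a := (abs_roundSite_sub_le ha hM0 u).trans (mesh_le_scale ha hM0)
    have : (v - u) ^ 2 ≤ scale a ^ 2 := by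
      rw [← sq_abs]; gcongr
    nlinarith [sq_nonneg (v + u - 2 * u), sq_nonneg (u - 2 * v)]
  calc (2 * stirlingConst + 4 * v ^ 2 / scale a ^ 2) * Real.exp (-(a * v ^ 4 + b * v ^ 2))
      ≤ (2 * stirlingConst + 4 / scale a ^ 2) * Real.exp (v ^ 2) *
          Real.exp (-(a * v ^ 4 + b * v ^ 2)) := by gcongr
    _ = (2 * stirlingConst + 4 / scale a ^ 2) *
          (Real.exp (-(a * v ^ 4 + b * v ^ 2) + v ^ 2 + 2 * k * v ^ 2) *
            Real.exp (-(2 * k * v ^ 2))) := by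
        rw [← Real.exp_add, mul_assoc, ← Real.exp_add]; congr 2; ring
    _ ≤ (2 * stirlingConst + 4 / scale a ^ 2) *
          (Real.exp (c ^ 2 / (4 * a)) * Real.exp (-k * u ^ 2 + 2 * k * scale a ^ 2)) := by
        have hC := stirlingConst_nonneg
        gcongr
    _ = _ := by rw [Real.exp_add]; ring

/-! ### The pointwise limit of the step density -/

/-- **The local limit** (de Moivre–Laplace with the Curie–Weiss tilt): for every `u`,
`g_M(u) → √(2/π) exp(-(a u⁴ + b u²))`. [cite: SimonGriffiths1973, §2 proof of Thm. 1] -/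
theorem tendsto_stepDensity {a : ℝ} (ha : 0 < a) (b u : ℝ) :
    Tendsto (fun M => stepDensity a b M u) atTop
      (𝓝 (Real.sqrt (2 / π) * Real.exp (-(a * u ^ 4 + b * u ^ 2)))) := by
  have hsc := scale_pos ha
  -- notation: the cell index `z M`, its natural version `j M`, the lattice point `v M → u`,
  -- the reduced variable `x M = v M / (λ M) → 0`
  set z : ℕ → ℤ := fun M => cellIndex a M u with hz
  set j : ℕ → ℕ := fun M => (z M).toNat with hj
  set v : ℕ → ℝ := fun M => roundSite a M u with hv
  set x : ℕ → ℝ := fun M => siteX M (z M) with hx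
  have hvu : Tendsto v atTop (𝓝 u) := tendsto_roundSite ha u
  have hxv : ∀ M : ℕ, M ≠ 0 → x M = v M / (scale a * M) := fun M hM => by
    have hM' : (M : ℝ) ≠ 0 := by exact_mod_cast hM
    have := site_eq (a := a) hM (z M)
    simp only [hx, hv, roundSite]
    rw [this]; field_simp
  have hx0 : Tendsto x atTop (𝓝 0) := by
    have h1 : Tendsto (fun M : ℕ => scale a * (M : ℝ)) atTop atTop :=
      tendsto_natCast_atTop_atTop.const_mul_atTop hsc
    refine (hvu.div_atTop h1).congr' ?_
    filter_upwards [eventually_ne_atTop 0] with M hM using (hxv M hM).symm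
  -- the good indices
  have hgood : ∀ᶠ M : ℕ in atTop, 2 ≤ M ∧ |x M| ≤ 1 / 2 := by
    refine (eventually_ge_atTop 2).and ?_
    have := (Metric.tendsto_nhds.1 hx0) (1 / 2) (by norm_num)
    filter_upwards [this] with M hM
    rw [Real.dist_0_eq_abs] at hM; exact hM.le
  -- on good indices: the Stirling form of `g_M(u)`
  have hform : ∀ᶠ M : ℕ in atTop, stepDensity a b M u =
      stirlingRatio (M ^ 4) (j M) * Real.sqrt (2 / (1 - x M ^ 2)) *
        Real.exp (-((M : ℝ) ^ 4 * rateRem (x M))) *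
          Real.exp (-(a * v M ^ 4 + b * v M ^ 2)) := by
    filter_upwards [hgood] with M hM
    obtain ⟨hz0, hj1, hj2, -, -⟩ := index_interior hM.1 hM.2
    have hM0 : M ≠ 0 := by omega
    have hzj : ((j M : ℕ) : ℤ) = z M := Int.toNat_of_nonneg hz0
    have e1 : stepDensity a b M u = (M : ℝ) ^ 2 / 2 ^ (M ^ 4) * cwWeight a b M (j M) := by
      simp only [stepDensity, hj, hz]; rw [if_pos hz0]
    have e2 : x M = siteX M (j M) := by simp only [hx]; rw [hzj]
    have e3 : v M = site a M (j M) := by simp only [hv, roundSite]; rw [hzj]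
    rw [e1, e2, e3]
    exact scaled_cwWeight_eq ha b hM0 hj1 hj2
  -- (a) the Stirling ratio tends to `1/√π`
  have hA : Tendsto (fun M => stirlingRatio (M ^ 4) (j M)) atTop (𝓝 (1 / Real.sqrt π)) := by
    have hjM : ∀ᶠ M : ℕ in atTop, M ≤ j M ∧ M ≤ M ^ 4 - j M := by
      filter_upwards [hgood] with M hM
      obtain ⟨-, -, -, h1, h2⟩ := index_interior hM.1 hM.2
      exact ⟨h1, h2⟩
    refine tendsto_stirlingRatio ?_ ?_
    · exact tendsto_atTop_mono' atTop (hjM.mono fun M hM => hM.1) tendsto_id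
    · exact tendsto_atTop_mono' atTop (hjM.mono fun M hM => hM.2) tendsto_id
  -- (b) `√(2/(1-x²)) → √2`
  have hB : Tendsto (fun M => Real.sqrt (2 / (1 - x M ^ 2))) atTop (𝓝 (Real.sqrt 2)) := by
    have := (tendsto_const_nhds (x := (2 : ℝ))).div ((hx0.pow 2).const_sub 1) (by norm_num)
    simpa using this.sqrt
  -- (c) `exp(-N r(x_M)) → 1`, since `0 ≤ N r(x) ≤ N x⁶/15 = (v/λ)⁶/(15 M²) → 0`
  have hC : Tendsto (fun M : ℕ => Real.exp (-((M : ℝ) ^ 4 * rateRem (x M)))) atTop (𝓝 1) := by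
    have hup : Tendsto (fun M : ℕ => (v M / scale a) ^ 6 / 15 / (M : ℝ) ^ 2) atTop (𝓝 0) := by
      refine Tendsto.div_atTop (((hvu.div_const (scale a)).pow 6).div_const 15) ?_
      exact (tendsto_pow_atTop (by norm_num)).comp tendsto_natCast_atTop_atTop
    have hr : Tendsto (fun M : ℕ => (M : ℝ) ^ 4 * rateRem (x M)) atTop (𝓝 0) := by
      refine tendsto_of_tendsto_of_tendsto_of_le_of_le' tendsto_const_nhds hup ?_ ?_
      · filter_upwards [hgood] with M hM
        have : x M ∈ Set.Icc (-1 : ℝ) 1 := by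
          rw [Set.mem_Icc, ← abs_le]; linarith [hM.2]
        exact mul_nonneg (by positivity) (rateRem_nonneg this)
      · filter_upwards [hgood] with M hM
        have hM0 : M ≠ 0 := by omega
        have hM' : (0 : ℝ) < M := by exact_mod_cast Nat.pos_of_ne_zero hM0
        have h6 := rateRem_le (x := x M) (by rw [Set.mem_Icc, ← abs_le]; exact hM.2)
        calc (M : ℝ) ^ 4 * rateRem (x M) ≤ (M : ℝ) ^ 4 * (x M ^ 6 / 15) := by gcongr
          _ = (v M / scale a) ^ 6 / 15 / (M : ℝ) ^ 2 := by
              rw [hxv M hM0]; field_simp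
    have := ((Real.continuous_exp.comp continuous_neg).tendsto 0).comp hr
    simpa [Function.comp_def] using this
  -- (d) the main factor
  have hD : Tendsto (fun M => Real.exp (-(a * v M ^ 4 + b * v M ^ 2))) atTop
      (𝓝 (Real.exp (-(a * u ^ 4 + b * u ^ 2)))) := by
    have hc : Continuous fun t : ℝ => Real.exp (-(a * t ^ 4 + b * t ^ 2)) := by fun_prop
    exact (hc.tendsto u).comp hvu
  have hlim := ((hA.mul hB).mul hC).mul hD
  have hval : 1 / Real.sqrt π * Real.sqrt 2 * 1 * Real.exp (-(a * u ^ 4 + b * u ^ 2)) =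
      Real.sqrt (2 / π) * Real.exp (-(a * u ^ 4 + b * u ^ 2)) := by
    rw [Real.sqrt_div' 2 pi_pos.le]; ring
  rw [← hval]
  exact hlim.congr' (hform.mono fun M hM => hM.symm)

/-! ### The `φ⁴` density -/

/-- The unnormalised single-site `φ⁴` density `exp(-a u⁴ - b u²)` — literally the integrand of the
tree's fact `isIsingLimitLaw_phi4`. (The barrier file `RigorousRGSmallParameter.lean` has the
double-well parametrisation `phi4SingleSpinDensity lam ξ = exp(-lam (ξ²-1)²) = e^{-lam} · (this with
a = lam, b = -2 lam)`; not merged, the parametrisations serve different statements.)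
[cite: SimonGriffiths1973, §2 Thm. 1] -/
def phi4Density (a b u : ℝ) : ℝ := Real.exp (-a * u ^ 4 - b * u ^ 2)

/-- `exp(-a u⁴ - b u²) = exp(-(a u⁴ + b u²))`. [folklore] -/
theorem phi4Density_eq (a b u : ℝ) : phi4Density a b u = Real.exp (-(a * u ^ 4 + b * u ^ 2)) := by
  unfold phi4Density; congr 1; ring

/-- `0 < exp(-a u⁴ - b u²)`. [folklore] -/
theorem phi4Density_pos (a b u : ℝ) : 0 < phi4Density a b u := Real.exp_pos _

/-- The `φ⁴` density is continuous. [folklore] -/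
theorem continuous_phi4Density (a b : ℝ) : Continuous (phi4Density a b) := by
  unfold phi4Density; fun_prop

/-- Gaussian domination of the `φ⁴` density: `e^{-a u⁴ - b u²} ≤ e^{(k-b)²/(4a)} e^{-k u²}`.
[folklore] -/
theorem phi4Density_le (a b k u : ℝ) (ha : 0 < a) :
    phi4Density a b u ≤ Real.exp ((k - b) ^ 2 / (4 * a)) * Real.exp (-k * u ^ 2) := by
  rw [phi4Density_eq, ← Real.exp_add, Real.exp_le_exp, ← sub_nonneg]
  have : (k - b) ^ 2 / (4 * a) + -k * u ^ 2 - -(a * u ^ 4 + b * u ^ 2) =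
      (2 * a * u ^ 2 - (k - b)) ^ 2 / (4 * a) := by
    field_simp; ring
  rw [this]; positivity

/-- The `φ⁴` density is integrable (`a > 0`). [folklore] -/
theorem integrable_phi4Density {a : ℝ} (ha : 0 < a) (b : ℝ) : Integrable (phi4Density a b) := by
  refine Integrable.mono' ((integrable_exp_neg_mul_sq one_pos).const_mul
    (Real.exp ((1 - b) ^ 2 / (4 * a)))) (continuous_phi4Density a b).aestronglyMeasurable
    (Eventually.of_forall fun u => ?_)
  rw [Real.norm_of_nonneg (phi4Density_pos a b u).le]
  exact phi4Density_le a b 1 u ha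

/-- More generally `φ · e^{-a u⁴ - b u²}` is integrable for continuous `φ` of Gaussian growth.
[folklore] -/
theorem integrable_mul_phi4Density {a : ℝ} (ha : 0 < a) (b : ℝ) {φ : ℝ → ℝ} (hφ : Continuous φ)
    {A B : ℝ} (hφb : ∀ u, |φ u| ≤ A * Real.exp (B * u ^ 2)) :
    Integrable fun u => φ u * phi4Density a b u := by
  refine Integrable.mono' ((integrable_exp_neg_mul_sq one_pos).const_mul
    (A * Real.exp ((B + 1 - b) ^ 2 / (4 * a))))
    (hφ.mul (continuous_phi4Density a b)).aestronglyMeasurable (Eventually.of_forall fun u => ?_)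
  rw [norm_mul, Real.norm_of_nonneg (phi4Density_pos a b u).le, Real.norm_eq_abs]
  have hA : 0 ≤ A := by
    have := (abs_nonneg _).trans (hφb 0); simpa using this
  calc |φ u| * phi4Density a b u
      ≤ A * Real.exp (B * u ^ 2) * (Real.exp ((B + 1 - b) ^ 2 / (4 * a)) *
          Real.exp (-(B + 1) * u ^ 2)) :=
        mul_le_mul (hφb u) (phi4Density_le a b (B + 1) u ha) (phi4Density_pos a b u).le
          (by positivity)
    _ = A * Real.exp ((B + 1 - b) ^ 2 / (4 * a)) * Real.exp (-1 * u ^ 2) := by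
        have : Real.exp (B * u ^ 2) * Real.exp (-(B + 1) * u ^ 2) = Real.exp (-1 * u ^ 2) := by
          rw [← Real.exp_add]; congr 1; ring
        rw [← this]; ring

/-- `0 < ∫ e^{-a u⁴ - b u²} du`. [folklore] -/
theorem integral_phi4Density_pos {a : ℝ} (ha : 0 < a) (b : ℝ) : 0 < ∫ u, phi4Density a b u := by
  rw [integral_pos_iff_support_of_nonneg (fun u => (phi4Density_pos a b u).le)
    (integrable_phi4Density ha b)]
  have : Function.support (phi4Density a b) = Set.univ :=
    Set.eq_univ_of_forall fun u => (phi4Density_pos a b u).ne'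
  rw [this]; simp

/-! ### From lattice sums to integrals, and the limit of lattice averages -/

/-- **Lattice sums are integrals of step functions**:
`∫ φ(v_M(u)) g_M(u) du = 2δ_M · M² 2⁻ᴺ · Σ_{j=0}^{N} W_M(j) φ(u_j)`. [folklore] -/
theorem integral_roundSite_mul_stepDensity {a : ℝ} (ha : 0 < a) (b : ℝ) {M : ℕ} (hM : M ≠ 0)
    (φ : ℝ → ℝ) :
    ∫ u, φ (roundSite a M u) * stepDensity a b M u =
      2 * mesh a M * ((M : ℝ) ^ 2 / 2 ^ (M ^ 4)) *
        ∑ j ∈ Finset.range (M ^ 4 + 1), cwWeight a b M j * φ (site a M j) := by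
  set F : ℤ → ℝ := fun z => if 0 ≤ z then
    φ (site a M z) * ((M : ℝ) ^ 2 / 2 ^ (M ^ 4) * cwWeight a b M z.toNat) else 0 with hF
  have hFu : ∀ u, φ (roundSite a M u) * stepDensity a b M u = F (cellIndex a M u) := by
    intro u
    simp only [hF, stepDensity, roundSite]
    split_ifs <;> simp
  have hF0 : ∀ z, F z ≠ 0 → 0 ≤ z ∧ z ≤ (M : ℤ) ^ 4 := by
    intro z hz
    simp only [hF] at hz
    split_ifs at hz with h0
    · refine ⟨h0, ?_⟩
      by_contra hlt
      apply hz
      have h1 : M ^ 4 < z.toNat := by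
        have : ((M ^ 4 : ℕ) : ℤ) < (z.toNat : ℤ) := by
          rw [Int.toNat_of_nonneg h0]; push_cast; exact not_le.1 hlt
        exact_mod_cast this
      rw [cwWeight_eq_zero a b h1]; simp
    · exact absurd rfl hz
  simp_rw [hFu]
  rw [integral_comp_cellIndex ha hM F hF0, Finset.mul_sum, Finset.mul_sum]
  refine Finset.sum_congr rfl fun j _ => ?_
  simp only [hF]
  rw [if_pos (by positivity), Int.toNat_natCast]
  ring

/-- **Lattice averages are ratios of step-function integrals**:
`Σ_j W_M(j) φ(u_j) / Σ_j W_M(j) = ∫ φ(v_M) g_M / ∫ g_M`. [folklore] -/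
theorem latticeAverage_eq_integral_div {a : ℝ} (ha : 0 < a) (b : ℝ) {M : ℕ} (hM : M ≠ 0)
    (φ : ℝ → ℝ) :
    (∑ j ∈ Finset.range (M ^ 4 + 1), cwWeight a b M j * φ (site a M j)) /
        (∑ j ∈ Finset.range (M ^ 4 + 1), cwWeight a b M j) =
      (∫ u, φ (roundSite a M u) * stepDensity a b M u) / (∫ u, stepDensity a b M u) := by
  have h1 := integral_roundSite_mul_stepDensity ha b hM φ
  have h2 := integral_roundSite_mul_stepDensity ha b hM fun _ => (1 : ℝ)
  simp only [one_mul, mul_one] at h2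
  have hM' : (0 : ℝ) < M := by exact_mod_cast Nat.pos_of_ne_zero hM
  have hc : 2 * mesh a M * ((M : ℝ) ^ 2 / 2 ^ (M ^ 4)) ≠ 0 := by
    have := mesh_pos ha hM; positivity
  rw [h1, h2, mul_div_mul_left _ _ hc]

/-- `φ(v_M(·)) g_M` is measurable (a function of the cell index). [folklore] -/
theorem measurable_roundSite_mul_stepDensity (a b : ℝ) (M : ℕ) (φ : ℝ → ℝ) :
    Measurable fun u => φ (roundSite a M u) * stepDensity a b M u := by
  have : (fun u => φ (roundSite a M u) * stepDensity a b M u) = fun u =>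
      (fun z : ℤ => φ (site a M z) * (if 0 ≤ z then
        (M : ℝ) ^ 2 / 2 ^ (M ^ 4) * cwWeight a b M z.toNat else 0)) (cellIndex a M u) := by
    funext u; simp only [stepDensity, roundSite]
  rw [this]
  exact measurable_comp_cellIndex a M (fun z : ℤ => φ (site a M z) * (if 0 ≤ z then
        (M : ℝ) ^ 2 / 2 ^ (M ^ 4) * cwWeight a b M z.toNat else 0))

/-- **Dominated convergence**: for continuous `φ` with `|φ(u)| ≤ A e^{B u²}`,
`∫ φ(v_M(u)) g_M(u) du → √(2/π) ∫ φ(u) e^{-a u⁴ - b u²} du`. [cite: SimonGriffiths1973, §2 proof of Thm. 1] -/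
theorem tendsto_integral_roundSite_mul_stepDensity {a : ℝ} (ha : 0 < a) (b : ℝ) {φ : ℝ → ℝ}
    (hφ : Continuous φ) {A B : ℝ} (hφb : ∀ u, |φ u| ≤ A * Real.exp (B * u ^ 2)) :
    Tendsto (fun M => ∫ u, φ (roundSite a M u) * stepDensity a b M u) atTop
      (𝓝 (Real.sqrt (2 / π) * ∫ u, φ u * phi4Density a b u)) := by
  have hsc := scale_pos ha
  have hA : 0 ≤ A := by
    have := (abs_nonneg _).trans (hφb 0); simpa using this
  obtain ⟨R, hR0, hR⟩ := stepDensity_le_gaussian ha b (k := 2 * |B| + 1) (by positivity)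
  rw [← tendsto_add_atTop_iff_nat 2]
  have hlim : ∀ u, Tendsto (fun n : ℕ => φ (roundSite a (n + 2) u) * stepDensity a b (n + 2) u)
      atTop (𝓝 (φ u * (Real.sqrt (2 / π) * phi4Density a b u))) := fun u => by
    refine Tendsto.mul ?_ ?_
    · exact ((hφ.tendsto u).comp (tendsto_roundSite ha u)).comp (tendsto_add_atTop_nat 2)
    · rw [phi4Density_eq]
      exact (tendsto_stepDensity ha b u).comp (tendsto_add_atTop_nat 2)
  have key := tendsto_integral_of_dominated_convergence (μ := volume)
    (F := fun (n : ℕ) u => φ (roundSite a (n + 2) u) * stepDensity a b (n + 2) u)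
    (f := fun u => φ u * (Real.sqrt (2 / π) * phi4Density a b u))
    (fun u => A * Real.exp (2 * |B| * scale a ^ 2) * R * Real.exp (-1 * u ^ 2))
    (fun n => (measurable_roundSite_mul_stepDensity a b (n + 2) φ).aestronglyMeasurable)
    ((integrable_exp_neg_mul_sq one_pos).const_mul _) (fun n => Eventually.of_forall fun u => ?_)
    (Eventually.of_forall hlim)
  · have : (fun u => φ u * (Real.sqrt (2 / π) * phi4Density a b u)) =
        fun u => Real.sqrt (2 / π) * (φ u * phi4Density a b u) := by
      funext u; ring
    rwa [this, integral_const_mul] at key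
  · -- the domination `|φ(v)| g ≤ A e^{B v²} g ≤ A e^{2|B|λ²} e^{2|B|u²} · R e^{-(2|B|+1)u²}`
    have hM2 : 2 ≤ n + 2 := by omega
    have hM0 : n + 2 ≠ 0 := by omega
    set v := roundSite a (n + 2) u
    have hg0 := stepDensity_nonneg a b (n + 2) u
    have hvu : (v - u) ^ 2 ≤ scale a ^ 2 := by
      have hd : |v - u| ≤ scale a :=
        (abs_roundSite_sub_le ha hM0 u).trans (mesh_le_scale ha hM0)
      rw [← sq_abs]; gcongr
    have hv2 : |B| * v ^ 2 ≤ 2 * |B| * scale a ^ 2 + 2 * |B| * u ^ 2 := by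
      have : v ^ 2 ≤ 2 * (v - u) ^ 2 + 2 * u ^ 2 := by nlinarith [sq_nonneg (v - 2 * u)]
      nlinarith [abs_nonneg B]
    rw [norm_mul, Real.norm_of_nonneg hg0, Real.norm_eq_abs]
    calc |φ v| * stepDensity a b (n + 2) u
        ≤ A * Real.exp (B * v ^ 2) * (R * Real.exp (-(2 * |B| + 1) * u ^ 2)) := by
          gcongr
          · exact hφb v
          · exact hR _ hM2 u
      _ ≤ A * Real.exp (2 * |B| * scale a ^ 2 + 2 * |B| * u ^ 2) *
          (R * Real.exp (-(2 * |B| + 1) * u ^ 2)) := by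
          gcongr
          have : B * v ^ 2 ≤ |B| * v ^ 2 := by nlinarith [le_abs_self B, sq_nonneg v]
          exact this.trans hv2
      _ = A * Real.exp (2 * |B| * scale a ^ 2) * R * Real.exp (-1 * u ^ 2) := by
          have he : Real.exp (2 * |B| * scale a ^ 2 + 2 * |B| * u ^ 2) *
              Real.exp (-(2 * |B| + 1) * u ^ 2) =
                Real.exp (2 * |B| * scale a ^ 2) * Real.exp (-1 * u ^ 2) := by
            rw [← Real.exp_add, ← Real.exp_add]; congr 1; ring
          calc A * Real.exp (2 * |B| * scale a ^ 2 + 2 * |B| * u ^ 2) *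
                (R * Real.exp (-(2 * |B| + 1) * u ^ 2))
              = A * R * (Real.exp (2 * |B| * scale a ^ 2 + 2 * |B| * u ^ 2) *
                  Real.exp (-(2 * |B| + 1) * u ^ 2)) := by ring
            _ = A * R * (Real.exp (2 * |B| * scale a ^ 2) * Real.exp (-1 * u ^ 2)) := by rw [he]
            _ = _ := by ring

/-- **Simon–Griffiths, Theorem 1 (lattice form)**: for continuous `φ` of Gaussian growth, the
Curie–Weiss lattice averages `Σ_j W_M(j) φ(u_j) / Σ_j W_M(j)` converge to
`∫ φ e^{-a u⁴ - b u²} / ∫ e^{-a u⁴ - b u²}`. [cite: SimonGriffiths1973, §2 Thm. 1] -/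
theorem tendsto_latticeAverage {a : ℝ} (ha : 0 < a) (b : ℝ) {φ : ℝ → ℝ} (hφ : Continuous φ)
    {A B : ℝ} (hφb : ∀ u, |φ u| ≤ A * Real.exp (B * u ^ 2)) :
    Tendsto (fun M : ℕ => (∑ j ∈ Finset.range (M ^ 4 + 1), cwWeight a b M j * φ (site a M j)) /
        (∑ j ∈ Finset.range (M ^ 4 + 1), cwWeight a b M j)) atTop
      (𝓝 ((∫ u, φ u * phi4Density a b u) / (∫ u, phi4Density a b u))) := by
  have hnum := tendsto_integral_roundSite_mul_stepDensity ha b hφ hφb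
  have hden := tendsto_integral_roundSite_mul_stepDensity ha b (φ := fun _ => (1 : ℝ))
    continuous_const (A := 1) (B := 0) (fun u => by simp)
  simp only [one_mul] at hden
  have hs : Real.sqrt (2 / π) ≠ 0 := by positivity
  have hne : Real.sqrt (2 / π) * ∫ u, phi4Density a b u ≠ 0 :=
    mul_ne_zero hs (integral_phi4Density_pos ha b).ne'
  have := hnum.div hden hne
  rw [mul_div_mul_left _ _ hs] at this
  refine this.congr' ?_
  filter_upwards [eventually_ne_atTop 0] with M hM
  exact (latticeAverage_eq_integral_div ha b hM φ).symm

end SimonGriffiths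

end Literature.Probability.LatticeModels

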